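import Summits.Ventures.HodgeRepro.ProdTransfer

/-!
# The reduced product `B_red = ∏_k Simple(Φ k)` on the model: the coset `G`-set of the CM algebra
`∏_k E^{rstab (Φ k)}` and Lemma R's combinatorial core on it

Blind re-derivation cell `pub-hodge-repro`, seat `night-1`.  Route C / Lemma R (`ROUTE.md` §1, S3ᴿ)
reduce a corner product `B = ∏_i A_{T i}`, `T i = Φ (cls i) · tw i`, to `B_red = ∏_k B_k` where `B_k` is
the SIMPLE factor of the representative `A_{Φ k}`: `A_{Φ k} ∼ B_k^{|rstab (Φ k)|}`, `B_k` with CM by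
`K_k = E^{rstab (Φ k)}` of type `Φ k` descended (a «lift corner `E ⊗_K F` counts as its base `E`», S3ᴿ).
The CM algebra of `B_red` is `∏_k K_k`, whose embeddings form the `G`-set

  `cosetSet Φ = Σ k, G ⧸ rstab (Φ k)`   (left cosets, `G` acting on the left),

with CM type `cosetType Φ = ⊔_k (Φ k)/rstab (Φ k)` (the descended types).  typer's `ProdTransfer.lean`
transfers Pohlmann's product criterion along a type map; here the type map is

  `cosetMap Φ : J × G → cosetSet Φ`, `(k, x) ↦ ⟨k, x · rstab (Φ k)⟩`,

`G`-equivariant and pulling `cosetType Φ` back to `(Φ k)_k` (`isTypeMap_cosetMap` — this uses only that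
`Φ k` is a union of right cosets of its right stabiliser).  Consequences:

* `isCMTypeOn_cosetType`: `cosetType Φ` is a CM type on the `G`-set (for CM types `Φ k`; `c ∉ rstab`);
* `card_cosetSet`: `|cosetSet Φ| = Σ_k |G| / |rstab (Φ k)|`, i.e. `2 · dim B_red`;
* **`isHodgeSetOn_cosetMap_reducedSet`** (Lemma R on the CM-algebra side, combinatorial core): for a
  `SumTwo` corner family with injective `(cls, tw)` and `cosetMap` injective on the reduced set `U_s`,
  the image `cosetMap(U_s) ⊆ cosetSet Φ` satisfies Pohlmann's condition for `cosetType Φ` — the `s`-line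
  of the Weil class of `B` is a Hodge line of codimension `|ι|/2` on `B_red`.

For primitive representatives (`rstab = ⊥`) the coset set is `J × G` itself and this is typer's
`isHodgeSetProd_reducedSet`.  Nothing here says anything about the status of the Hodge conjecture for CM
abelian varieties, which is NOT proved.
-/

open Finset
open scoped Pointwise

namespace HodgeRepro.RouteC

variable {G : Type*} [Group G] [DecidableEq G] {J : Type*}

/-- The embedding `G`-set of the CM algebra `∏_k E^{rstab (Φ k)}` of the reduced product: the disjoint
union of the left coset spaces `G ⧸ rstab (Φ k)`. -/
abbrev cosetSet (Φ : J → Finset G) : Type _ := Σ k : J, G ⧸ rstab (Φ k)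

/-- `G` acts on `cosetSet Φ` on the left, fibrewise. -/
instance instMulActionCosetSet (Φ : J → Finset G) : MulAction G (cosetSet Φ) where
  smul g x := ⟨x.1, g • x.2⟩
  one_smul x := by
    rcases x with ⟨k, y⟩
    show (⟨k, (1 : G) • y⟩ : cosetSet Φ) = ⟨k, y⟩
    rw [one_smul]
  mul_smul g h x := by
    rcases x with ⟨k, y⟩
    show (⟨k, (g * h) • y⟩ : cosetSet Φ) = ⟨k, g • h • y⟩
    rw [mul_smul]

omit [DecidableEq G] in
/-- The action, unfolded. -/
@[simp] theorem smul_cosetSet_mk (Φ : J → Finset G) (g : G) (k : J) (y : G ⧸ rstab (Φ k)) :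
    g • (⟨k, y⟩ : cosetSet Φ) = ⟨k, g • y⟩ := rfl

/-- The type map `(k, x) ↦ ⟨k, x · rstab (Φ k)⟩`. -/
def cosetMap (Φ : J → Finset G) (q : J × G) : cosetSet Φ := ⟨q.1, (q.2 : G ⧸ rstab (Φ q.1))⟩

variable [Fintype G] [Fintype J] [DecidableEq J]

/-- The CM type of the reduced product on `cosetSet Φ`: the descended types `(Φ k)/rstab (Φ k)`. -/
def cosetType (Φ : J → Finset G) : Finset (cosetSet Φ) :=
  (univ : Finset J).sigma fun k => (Φ k).image (fun x : G => (x : G ⧸ rstab (Φ k)))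

omit [Fintype G] [DecidableEq J] in
/-- A coset `x · rstab (Φ k)` lies in the descended type iff `x ∈ Φ k` (`Φ k` is a union of right cosets of
its right stabiliser). -/
theorem mk_mem_cosetType_iff (Φ : J → Finset G) (k : J) (x : G) :
    (⟨k, (x : G ⧸ rstab (Φ k))⟩ : cosetSet Φ) ∈ cosetType Φ ↔ x ∈ Φ k := by
  unfold cosetType
  rw [Finset.mem_sigma]
  simp only [Finset.mem_univ, true_and, Finset.mem_image]
  constructor
  · rintro ⟨y, hy, hyx⟩
    rw [QuotientGroup.eq] at hyx
    have hyx' := hyx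
    rw [mem_rstab] at hyx'
    rw [← hyx', mem_rmul, mul_inv_rev, inv_inv, ← mul_assoc, mul_inv_cancel, one_mul]
    exact hy
  · intro hx
    exact ⟨x, hx, rfl⟩

omit [Fintype G] [DecidableEq J] in
/-- **`cosetMap` is a type map** for `(Φ k)_k` and `cosetType Φ` (typer's `IsTypeMap`). -/
theorem isTypeMap_cosetMap (Φ : J → Finset G) : IsTypeMap Φ (cosetType Φ) (cosetMap Φ) where
  equivariant k τ x := by
    show (⟨k, ((τ * x : G) : G ⧸ rstab (Φ k))⟩ : cosetSet Φ) = ⟨k, τ • (x : G ⧸ rstab (Φ k))⟩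
    rw [MulAction.Quotient.smul_mk, smul_eq_mul]
  mem_iff k x := mk_mem_cosetType_iff Φ k x

omit [DecidableEq G] [Fintype G] [DecidableEq J] [Fintype J] in
/-- Two cosets `x · rstab (Φ k)`, `y · rstab (Φ k)` coincide iff `y ∈ Φ k · …`: `(x : G ⧸ rstab Φ) = y ↔
x⁻¹ * y ∈ rstab Φ` (Mathlib's `QuotientGroup.eq`). -/
theorem cosetMap_eq_iff (Φ : J → Finset G) (k : J) (x y : G) :
    cosetMap Φ (k, x) = cosetMap Φ (k, y) ↔ x⁻¹ * y ∈ rstab (Φ k) := by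
  unfold cosetMap
  rw [Sigma.mk.inj_iff]
  simp only [heq_eq_eq, true_and]
  exact QuotientGroup.eq

omit [DecidableEq G] [Fintype G] [DecidableEq J] [Fintype J] in
/-- A decidable criterion for the injectivity of `cosetMap Φ` on a finite set `S ⊆ J × G`: two elements
of `S` in the same class whose twists differ by an element of the right stabiliser
(`rmul (Φ k) (x⁻¹ y) = Φ k`) are equal. -/
theorem injOn_cosetMap_of_forall (Φ : J → Finset G) (S : Finset (J × G))
    (h : ∀ a ∈ S, ∀ b ∈ S, (a.1 = b.1 ∧ rmul (Φ a.1) (a.2⁻¹ * b.2) = Φ a.1) → a = b) :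
    Set.InjOn (cosetMap Φ) S := by
  intro a ha b hb hab
  have h1 : a.1 = b.1 := congrArg Sigma.fst hab
  refine h a ha b hb ⟨h1, ?_⟩
  obtain ⟨k, x⟩ := a
  obtain ⟨l, y⟩ := b
  simp only at h1
  subst h1
  exact (cosetMap_eq_iff Φ k x y).1 hab

omit [DecidableEq G] [Fintype G] [DecidableEq J] [Fintype J] in
/-- For PRIMITIVE representatives (`rstab = ⊥`) the coset map is injective: the coset `G`-set is
`J × G` itself. -/
theorem cosetMap_injective_of_isPrimitive {Φ : J → Finset G} (hΦ : ∀ k, IsPrimitive (Φ k)) :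
    Function.Injective (cosetMap Φ) := by
  rintro ⟨k, x⟩ ⟨l, y⟩ h
  have hk : k = l := congrArg Sigma.fst h
  subst hk
  rw [cosetMap_eq_iff, (isPrimitive_iff_rstab_eq_bot _).1 (hΦ k), Subgroup.mem_bot,
    inv_mul_eq_one] at h
  rw [h]

omit [Fintype G] [DecidableEq J] in
/-- `cosetType Φ` is a CM type on the `G`-set `cosetSet Φ` when every `Φ k` is a CM type. -/
theorem isCMTypeOn_cosetType {c : G} {Φ : J → Finset G}
    (hΦ : ∀ k, IsCMType c (Φ k)) : IsCMTypeOn c (cosetType Φ) := by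
  rintro ⟨k, y⟩
  induction y using QuotientGroup.induction_on with
  | H x =>
    change (⟨k, (x : G ⧸ rstab (Φ k))⟩ : cosetSet Φ) ∈ cosetType Φ ↔
      (⟨k, c • (x : G ⧸ rstab (Φ k))⟩ : cosetSet Φ) ∉ cosetType Φ
    rw [MulAction.Quotient.smul_mk, smul_eq_mul, mk_mem_cosetType_iff, mk_mem_cosetType_iff]
    exact hΦ k x

omit [DecidableEq G] [DecidableEq J] [Fintype J] in
/-- The coset space `G ⧸ rstab Φ` has `|G| / |rstab Φ|` elements. -/
theorem card_quotient_rstab (Φ : Finset G) :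
    Nat.card (G ⧸ rstab Φ) = Nat.card G / Nat.card (rstab Φ) := by
  rw [Subgroup.card_eq_card_quotient_mul_card_subgroup (rstab Φ), Nat.mul_div_cancel _ Nat.card_pos]

omit [DecidableEq J] in
/-- `|cosetSet Φ| = Σ_k |G| / |rstab (Φ k)| = 2 · dim B_red`. -/
theorem card_cosetSet (Φ : J → Finset G) :
    Nat.card (cosetSet Φ) = ∑ k, Nat.card G / Nat.card (rstab (Φ k)) := by
  rw [Nat.card_eq_fintype_card, Fintype.card_sigma]
  exact Finset.sum_congr rfl fun k _ => by rw [← Nat.card_eq_fintype_card, card_quotient_rstab]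

omit [Fintype G] in
/-- **Lemma R on the CM-algebra side (combinatorial core)**: for a `SumTwo` corner family
`T i = Φ (cls i) · tw i` with injective `(cls, tw)` and `cosetMap Φ` injective on the reduced set `U_s`,
the image `cosetMap Φ (U_s)` satisfies Pohlmann's condition for the type `cosetType Φ` of the reduced
product `B_red = ∏_k Simple (Φ k)`. -/
theorem isHodgeSetOn_cosetMap_reducedSet {ι : Type*} [Fintype ι] {c : G} (hc : IsComplexConj c)
    (Φ : J → Finset G) (cls : ι → J) (tw : ι → G)
    (hinj : Function.Injective fun i => (cls i, tw i)) (hsum : SumTwo (corner Φ cls tw)) (s : G)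
    (hρ : Set.InjOn (cosetMap Φ) (reducedSet cls tw s)) :
    IsHodgeSetOn c (cosetType Φ) ((reducedSet cls tw s).image (cosetMap Φ)) := by
  rw [(isTypeMap_cosetMap Φ).isHodgeSetOn_image_iff c _ hρ]
  exact isHodgeSetProd_reducedSet hc Φ cls tw hinj hsum s

omit [Fintype G] [Fintype J] in
/-- The image of the reduced set has `|ι|` elements when `cosetMap` is injective on it. -/
theorem card_image_cosetMap_reducedSet {ι : Type*} [Fintype ι] (Φ : J → Finset G) (cls : ι → J)
    (tw : ι → G) (hinj : Function.Injective fun i => (cls i, tw i)) (s : G)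
    (hρ : Set.InjOn (cosetMap Φ) (reducedSet cls tw s)) :
    ((reducedSet cls tw s).image (cosetMap Φ)).card = Fintype.card ι := by
  rw [Finset.card_image_of_injOn hρ, card_reducedSet cls tw hinj s]

end HodgeRepro.RouteC
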